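import Summits.BirchSwinnertonDyer.BirchSwinnertonDyer.Theorems.KimAtThreeStubPairCountAtEmpty
import Summits.BirchSwinnertonDyer.Rank1Residual.GaloisImage.KolyvaginPropagatedLevelCount
import HarnessLib

/-!
# The Poitou–Tate pair count at every Kolyvagin LEVEL WITHOUT a port:
# `#H¹_{𝓕_can(d)}(ℚ, E[3^{k+1}]) = 3^{k+1} · #H¹_{𝓕_can(d)^*}(ℚ, E[3^{k+1}]^D)`
# (item stmt-BirchSwinnertonDyer-19561 `KimAtThreeKolyvagin.StubAtEmptyLevelThree`, helper; seat
# bsd-addord-w2-c5 gen 4; route-independent module — no Theses import)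

n1011-p18's `DeepLedger.natCard_selmerGroup_propagated_atLevel_eq` (the count at a transverse level
`d`, Rubin Ex. 2.1.4 / Mazur–Rubin Cor. 2.3.6: `λ(d) − λ^*(d)` is constant along the levels) uses
the `Λ`-clauses of the Kato–Kurihara port ONLY through the empty-level count.  With the local index
now a theorem (this seat's p502450 `natCard_propagatedSelmerStructure_three_of_mem`), the level
count holds for `p = 3` with NO port and NO `hEP` binder:
* `natCard_selmerGroup_propagated_atLevel_eq_of_localIndex` — n1011-p18's theorem with
  `Λ / hon / hker` replaced by the bare index `hidx` (proof verbatim);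
* **`natCard_selmerGroup_propagated_atLevel_three_eq`** — `p = 3`: the binders are exactly
  n1011-p18's MINUS `Λ, hon, hker, hEP` (the Poitou–Tate family with IsPerfect / SumLocalTermEqZero /
  SelmerComplement, an admissible `T ∋ v₃`, `Sel_{3^{k+1}}(E/ℚ)` finite, a datum `D` with primes off
  `T` and `#H¹_ur = #𝒯` at its primes, a level `d`).  This is the binder `hcountd` of the W2 port
  consumers (`KimAtThreeDeepUpperOfPorts`, `…OffStratumPortE(Deep)`, `…ShallowEqDeepStubOfPorts`,
  `…DeepLowerPortDeepTorsionUpperEngine`) with the port's `(Λ)`-count clauses no longer needed for it.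
References: [Rubin2011] Ex. 2.1.4; [MazurRubin2004] Cor. 2.3.6, Prop. 2.3.5; [MilneADT2006] I Thm. 2.8, 4.10.
-/

set_option autoImplicit false
-- the Theorems namespace of a single-conjunct summit repeats the summit name by design (D-0017)
set_option linter.dupNamespace false

noncomputable section

open scoped Classical NumberField ContRepresentation
open Function Field NumberField IsDedekindDomain WeierstrassCurve Literature.NumberTheory.EllipticCurves
  Literature.NumberTheory.GaloisRepresentations Literature.NumberTheory.GaloisRepresentations.DiscreteGaloisModule
  Literature.NumberTheory.GaloisCohomology Literature.NumberTheory.GaloisCohomology.KolyvaginDatum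
  Summit.BirchSwinnertonDyer.Rank1Residual.GaloisImage

namespace Summit.BirchSwinnertonDyer.BirchSwinnertonDyer.Theorems.KimAtThreeStubLocalIndex

section Level

variable (W : WeierstrassCurve ℚ) [W.IsElliptic] (p : ℕ) [hp : Fact p.Prime] (k : ℕ)

/-- **`#H¹_{𝓕_can(d)}(ℚ, E[p^{k+1}]) = p^{k+1} · #H¹_{𝓕_can(d)^*}(ℚ, E[p^{k+1}]^D)`** at every level
`d` (`p` odd) — n1011-p18's `DeepLedger.natCard_selmerGroup_propagated_atLevel_eq` with the
`Λ`-clauses replaced by the bare local index `hidx : #𝓕_can(v_p) = p^{k+1} · #𝓚(v_p)`; proof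
verbatim (empty-level count, finiteness of `H¹_{𝓕_can}` and of its dual, p11's level-independence
`CoreRankZero.card_selmerGroup_atLevel_mul`).
[cite: Rubin2011, Exercise 2.1.4 (p. 18)] [cite: MazurRubin2004, Cor. 2.3.6 and Prop. 2.3.5] -/
theorem natCard_selmerGroup_propagated_atLevel_eq_of_localIndex (hp2 : p ≠ 2)
    {v₀ : HeightOneSpectrum (𝓞 ℚ)} (hv₀ : ((p : ℕ) : 𝓞 ℚ) ∈ v₀.asIdeal)
    [Finite (geomTorsion W ((p : ℤ) ^ k * (p : ℤ)))]
    (hidx : Nat.card (propagatedSelmerStructure W p k (Sum.inr v₀)) =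
      p ^ (k + 1) * Nat.card (W.kummerSelmerStructure ((p : ℤ) ^ k * (p : ℤ)) (Sum.inr v₀)))
    (inv : LocalInvariants ℚ (p ^ (k + 1))) (hperf : inv.IsPerfect) (hsum : inv.SumLocalTermEqZero)
    (hcompl : inv.SelmerComplement)
    (hinj : ∀ v : HeightOneSpectrum (𝓞 ℚ), Injective (inv (Sum.inr v)))
    (hEP : ∀ v : HeightOneSpectrum (𝓞 ℚ), localEulerPoincareCharacteristic (v.adicCompletion ℚ))
    (T : Finset (HeightOneSpectrum (𝓞 ℚ))) (hv₀T : v₀ ∈ T)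
    (hT : ∀ v : HeightOneSpectrum (𝓞 ℚ), v ∉ T →
      (((p ^ (k + 1) : ℕ) : ℕ) : 𝓞 ℚ) ∉ v.asIdeal ∧
        GaloisRep.IsUnramifiedAt v (W.torsionGaloisModule ((p : ℤ) ^ k * (p : ℤ))))
    (h𝓕T : (propagatedSelmerStructure W p k).IsUnramifiedOutside (finSupport T))
    (h𝓚T : (W.kummerSelmerStructure ((p : ℤ) ^ k * (p : ℤ))).IsUnramifiedOutside (finSupport T))
    [Finite (W.kummerSelmerStructure ((p : ℤ) ^ k * (p : ℤ))).selmerGroup]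
    (D : KolyvaginDatum (W.torsionGaloisModule ((p : ℤ) ^ k * (p : ℤ))))
    (hPS : ∀ q ∈ D.primes, q ∉ T)
    (hUT : ∀ q ∈ D.primes,
      Nat.card (unramifiedSubgroup (GaloisRep.toLocal q (W.torsionGaloisModule ((p : ℤ) ^ k * (p : ℤ)))) 1) =
        Nat.card (D.transverse (Sum.inr q)))
    {d : Finset (HeightOneSpectrum (𝓞 ℚ))} (hd : D.IsLevel d) :
    Nat.card (D.atLevel (propagatedSelmerStructure W p k) d).selmerGroup =
      p ^ (k + 1) * Nat.card (inv.dualSelmerStructure (W.torsionGaloisModule ((p : ℤ) ^ k * (p : ℤ)))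
        (D.atLevel (propagatedSelmerStructure W p k) d)).selmerGroup := by
  haveI : NeZero (p ^ (k + 1)) := ⟨pow_ne_zero _ hp.out.ne_zero⟩
  -- the empty-level count
  have h0 := natCard_selmerGroup_propagated_eq_of_localIndex W p k hp2 hv₀ hidx inv hperf hsum hcompl
    hinj hEP T hv₀T hT h𝓕T h𝓚T
  -- `E[p^{k+1}]` is killed by `p^{k+1}`
  have hM : ∀ m : geomTorsion W ((p : ℤ) ^ k * (p : ℤ)), (p ^ (k + 1)) • m = 0 := fun m => by
    have h := W.natAbs_nsmul_geomTorsion m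
    rwa [show ((p : ℤ) ^ k * (p : ℤ)).natAbs = p ^ (k + 1) by
      rw [Int.natAbs_mul, Int.natAbs_pow, Int.natAbs_natCast, pow_succ]] at h
  -- `H¹_{𝓕_can}` is finite: `𝓕_can = 𝓚` off `v₀`
  have hfin : Finite (propagatedSelmerStructure W p k).selmerGroup := by
    refine CoreRankZero.finite_selmerGroup_of_le_off {v₀}
      (𝓛 := W.kummerSelmerStructure ((p : ℤ) ^ k * (p : ℤ))) (fun v hv => le_of_eq ?_) inferInstance
    rcases v with w | v
    · exact DeepLedger.apply_inl_eq_of_odd W p k hp2 _ _ w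
    · have hne : v ≠ v₀ := fun h => hv v₀ (Finset.mem_singleton_self v₀) (by rw [h])
      have hpv : ((p : ℕ) : 𝓞 ℚ) ∉ v.asIdeal := fun h' =>
        hne (heightOneSpectrum_eq_of_natCast_mem hp.out h' hv₀)
      exact propagatedSelmerStructure_inr_eq_kummerSelmerStructure W p k hpv
  have hne : Nat.card (propagatedSelmerStructure W p k).selmerGroup ≠ 0 := Nat.card_pos.ne'
  -- so its dual Selmer group is finite too
  have hN0 : Nat.card (inv.dualSelmerStructure (W.torsionGaloisModule ((p : ℤ) ^ k * (p : ℤ)))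
      (propagatedSelmerStructure W p k)).selmerGroup ≠ 0 := by
    intro h
    rw [h, mul_zero] at h0
    exact hne h0
  have hfind : Finite (inv.dualSelmerStructure (W.torsionGaloisModule ((p : ℤ) ^ k * (p : ℤ)))
      (propagatedSelmerStructure W p k)).selmerGroup := Nat.finite_of_card_ne_zero hN0
  -- admissibility off `S(T)`
  have hS : ∀ v : HeightOneSpectrum (𝓞 ℚ), (Sum.inr v : Place ℚ) ∉ finSupport T →
      (((p ^ (k + 1) : ℕ) : ℕ) : 𝓞 ℚ) ∉ v.asIdeal ∧
        GaloisRep.IsUnramifiedAt v (W.torsionGaloisModule ((p : ℤ) ^ k * (p : ℤ))) := fun v hv =>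
    hT v fun h => hv ((inr_mem_finSupport_iff T v).2 h)
  have hPS' : ∀ q ∈ D.primes, (Sum.inr q : Place ℚ) ∉ finSupport T := fun q hq h =>
    hPS q hq ((inr_mem_finSupport_iff T q).1 h)
  -- `λ(d) − λ^*(d)` is constant along the levels (p11, Rubin Ex. 2.1.4)
  have hmul := CoreRankZero.card_selmerGroup_atLevel_mul hperf hsum hcompl hM hS h𝓕T hfin hfind
    hPS' hUT hd
  rw [h0] at hmul
  refine mul_right_cancel₀ hN0 ?_
  rw [hmul]
  ring

end Level

/-- **The pair count at every Kolyvagin level for `p = 3`, NO port, NO `hEP` binder: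
`#H¹_{𝓕_can(d)}(ℚ, E[3^k·3]) = 3^{k+1} · #H¹_{𝓕_can(d)^*}(ℚ, E[3^k·3]^D)`.**  Binders = n1011-p18's
`DeepLedger.natCard_selmerGroup_propagated_atLevel_eq` minus `Λ, hon, hker, hEP` (the local index is
this seat's `natCard_propagatedSelmerStructure_three_of_mem`; Tate's local Euler–Poincaré
characteristic is the theorem `EP.forall_localEulerPoincareCharacteristic_adicCompletion`).
[cite: Rubin2011, Exercise 2.1.4 (p. 18)] [cite: MazurRubin2004, Cor. 2.3.6 and Prop. 2.3.5] -/
theorem natCard_selmerGroup_propagated_atLevel_three_eq (W : WeierstrassCurve ℚ) [W.IsElliptic] (k : ℕ)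
    {v₀ : HeightOneSpectrum (𝓞 ℚ)} (hv₀ : ((3 : ℕ) : 𝓞 ℚ) ∈ v₀.asIdeal)
    [Finite (geomTorsion W (((3 : ℕ) : ℤ) ^ k * ((3 : ℕ) : ℤ)))]
    (inv : LocalInvariants ℚ (3 ^ (k + 1))) (hperf : inv.IsPerfect) (hsum : inv.SumLocalTermEqZero)
    (hcompl : inv.SelmerComplement)
    (T : Finset (HeightOneSpectrum (𝓞 ℚ))) (hv₀T : v₀ ∈ T)
    (hT : ∀ v : HeightOneSpectrum (𝓞 ℚ), v ∉ T →
      (((3 ^ (k + 1) : ℕ) : ℕ) : 𝓞 ℚ) ∉ v.asIdeal ∧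
        GaloisRep.IsUnramifiedAt v (W.torsionGaloisModule (((3 : ℕ) : ℤ) ^ k * ((3 : ℕ) : ℤ))))
    (h𝓕T : haveI : Fact (Nat.Prime 3) := ⟨Nat.prime_three⟩
      (propagatedSelmerStructure W 3 k).IsUnramifiedOutside (finSupport T))
    (h𝓚T : (W.kummerSelmerStructure (((3 : ℕ) : ℤ) ^ k * ((3 : ℕ) : ℤ))).IsUnramifiedOutside (finSupport T))
    [Finite (W.kummerSelmerStructure (((3 : ℕ) : ℤ) ^ k * ((3 : ℕ) : ℤ))).selmerGroup]
    (D : KolyvaginDatum (W.torsionGaloisModule (((3 : ℕ) : ℤ) ^ k * ((3 : ℕ) : ℤ))))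
    (hPS : ∀ q ∈ D.primes, q ∉ T)
    (hUT : ∀ q ∈ D.primes,
      Nat.card (unramifiedSubgroup (GaloisRep.toLocal q
        (W.torsionGaloisModule (((3 : ℕ) : ℤ) ^ k * ((3 : ℕ) : ℤ)))) 1) =
        Nat.card (D.transverse (Sum.inr q)))
    {d : Finset (HeightOneSpectrum (𝓞 ℚ))} (hd : D.IsLevel d) :
    haveI : Fact (Nat.Prime 3) := ⟨Nat.prime_three⟩
    Nat.card (D.atLevel (propagatedSelmerStructure W 3 k) d).selmerGroup =
      3 ^ (k + 1) * Nat.card (inv.dualSelmerStructure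
        (W.torsionGaloisModule (((3 : ℕ) : ℤ) ^ k * ((3 : ℕ) : ℤ)))
        (D.atLevel (propagatedSelmerStructure W 3 k) d)).selmerGroup := by
  haveI : Fact (Nat.Prime 3) := ⟨Nat.prime_three⟩
  exact natCard_selmerGroup_propagated_atLevel_eq_of_localIndex W 3 k (by norm_num) hv₀
    (natCard_propagatedSelmerStructure_three_of_mem W v₀ hv₀ k) inv hperf hsum hcompl
    (fun v => (hperf v).1.injective) (EP.forall_localEulerPoincareCharacteristic_adicCompletion ℚ)
    T hv₀T hT h𝓕T h𝓚T D hPS hUT hd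

/-- **The pair count at `∅` for `p = 3` with the consumers' `T`-binders (NO port, NO `hEP`)** — the
binder `hcount0` of the W2 port consumers verbatim minus `Λ, hon, hker, hEP`.
[cite: MazurRubin2004, Prop. 2.3.5] [cite: MilneADT2006, Ch. I, Thm. 2.8 and Thm. 4.10] -/
theorem natCard_selmerGroup_propagated_three_eq_of_admissible (W : WeierstrassCurve ℚ) [W.IsElliptic]
    (k : ℕ) {v₀ : HeightOneSpectrum (𝓞 ℚ)} (hv₀ : ((3 : ℕ) : 𝓞 ℚ) ∈ v₀.asIdeal)
    [Finite (geomTorsion W (((3 : ℕ) : ℤ) ^ k * ((3 : ℕ) : ℤ)))]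
    (inv : LocalInvariants ℚ (3 ^ (k + 1))) (hperf : inv.IsPerfect) (hsum : inv.SumLocalTermEqZero)
    (hcompl : inv.SelmerComplement)
    (T : Finset (HeightOneSpectrum (𝓞 ℚ))) (hv₀T : v₀ ∈ T)
    (hT : ∀ v : HeightOneSpectrum (𝓞 ℚ), v ∉ T →
      (((3 ^ (k + 1) : ℕ) : ℕ) : 𝓞 ℚ) ∉ v.asIdeal ∧
        GaloisRep.IsUnramifiedAt v (W.torsionGaloisModule (((3 : ℕ) : ℤ) ^ k * ((3 : ℕ) : ℤ))))
    (h𝓕T : haveI : Fact (Nat.Prime 3) := ⟨Nat.prime_three⟩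
      (propagatedSelmerStructure W 3 k).IsUnramifiedOutside (finSupport T))
    (h𝓚T : (W.kummerSelmerStructure (((3 : ℕ) : ℤ) ^ k * ((3 : ℕ) : ℤ))).IsUnramifiedOutside (finSupport T))
    [Finite (W.kummerSelmerStructure (((3 : ℕ) : ℤ) ^ k * ((3 : ℕ) : ℤ))).selmerGroup] :
    haveI : Fact (Nat.Prime 3) := ⟨Nat.prime_three⟩
    Nat.card (propagatedSelmerStructure W 3 k).selmerGroup =
      3 ^ (k + 1) * Nat.card (inv.dualSelmerStructure
        (W.torsionGaloisModule (((3 : ℕ) : ℤ) ^ k * ((3 : ℕ) : ℤ))) (propagatedSelmerStructure W 3 k)).selmerGroup := by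
  haveI : Fact (Nat.Prime 3) := ⟨Nat.prime_three⟩
  exact natCard_selmerGroup_propagated_eq_of_localIndex W 3 k (by norm_num) hv₀
    (natCard_propagatedSelmerStructure_three_of_mem W v₀ hv₀ k) inv hperf hsum hcompl
    (fun v => (hperf v).1.injective) (EP.forall_localEulerPoincareCharacteristic_adicCompletion ℚ)
    T hv₀T hT h𝓕T h𝓚T

end Summit.BirchSwinnertonDyer.BirchSwinnertonDyer.Theorems.KimAtThreeStubLocalIndex

end
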